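import Summits.ABC.ABC.Theorems.IUTThetaPilotThetaPartIIDisplay
import Summits.ABC.IUTFork.LDHGenuinePoint
import Literature.IUT.LogVolume.Corollary23ChainUpTo
import Summits.ABC.ABC.Theorems.IUTThetaPilotThetaPartIIStubThetaData
import Summits.ABC.ABC.Theorems.IUTThetaPilotThetaPartIIStubThetaDataPrelims
import Summits.ABC.IUTFork.LDHGenuineTowerArithPinned
import Literature.IUT.LogVolume.GenuineRamificationBoundsPinned
import Literature.IUT.LogVolume.GenuineLogThetaPerImage
import HarnessLib

/-!
# Route `IUTThetaPilot`, crux `ThetaPartII` (stmt-ABC-19678): the BOUNDED-DEGREE cut — Vojta on compactly bounded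
# sets in degree `≤ d₀` from children (iii) and (ii′) AT POINTS OF DEGREE `≤ d₀` only; the «d = 1 cut»

Mochizuki, *Inter-universal Teichmüller theory IV*, RIMS manuscript (Apr. 2020; = PRIMS **57** (2021)), Thm. 1.10
(pp. 22–31), Cor. 2.2 (ii) (pp. 41–48), Cor. 2.3 (p. 55); [IUTchIII] Cor. 3.12 (kurims p. 174).

PROOF-ONLY helper on the crux item (does not close it). The registered skeleton `ThetaPartII.Display` (v1.2)
reduces the crux to children (i) `stub_thetaData` (a THEOREM: `Summit.ABC.ABC.Theorems.ThetaPartII.stub_thetaData`, abc-iut-L5-t7 g5 over abc-iut-S2's `ThetaGeometryInhabited`), (iii)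
`stub_cor312` ([IUTchIII] Cor. 3.12 at every genuine Θ-volume datum — DISPUTED) and (ii′) `stub_hullVolume` (the
computable half with print's `B_III(P,l)`), each ∀-quantified over all admissible `(P, l)`. The whole chain below the
crux is POINTWISE IN THE DEGREE of `P` (`Corollary22PartIIUpTo.lean`, `Corollary23ChainUpTo.lean`), so the same
children RESTRICTED TO POINTS OF DEGREE `≤ d₀` already give the degree-`≤ d₀` clauses of [GenEll] Thm. 2.1 (ii) at
`Σ = {2}`:

* `thm110LegendreUpTo_of_squeezeIII` — the squeeze with `B_III` at every admissible point of degree `≤ d₀` gives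
  `Cor22.Thm110LegendreUpTo d₀` (print's Step (viii), `display_of_squeezeIII`; `l ≠ 5` as in `thm110Legendre_of_pointwise`);
* **`vojtaIneq_two_degLe_of_cor312_of_hullVolume`** — children (iii) and (ii′) AT POINTS OF DEGREE `≤ d₀` give, for
  every `1 ≤ d ≤ d₀`, `ε > 0` and every compactly bounded `K_V` whose support contains `2`, Vojta's inequality
  `ht ≲ (1+ε)(log-diff + log-cond)` on `K_V ∩ U_P(ℚ̄)^{≤d}`;
* **`vojtaIneq_two_degOne_of_cor312_of_hullVolume`** — the «d = 1 cut»: at DEGREE-1 points (`λ ∈ ℚ`, `F_mod = ℚ`,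
  `d_mod = 1` — where [IUTchIV] Step (v)'s tensor-packet collections are slot-constant, one place of `F_mod` over each
  `p`, so the (Ind1)-symmetrisation question recorded in plan/c312/STEPV-IND1-NOTE.md does not arise) Cor. 3.12 at the
  Θ-data and the hull estimate give Vojta/Szpiro with the printed `(1+ε)` for all rational `λ` in every compactly
  bounded `K_V` with `2` in its support (for the Frey–Legendre parameter `λ = a/c` of an abc triple: `a ≍ b ≍ c`,
  `v₂(abc)` bounded — a positive-proportion, still open, family).

CONDITIONAL (`proof.conditional`); nothing is asserted; no side is taken on [IUTchIII] Cor. 3.12. The statements do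
not use `GenEllTwo` (no Belyi maps are needed in bounded degree on compactly bounded sets).
-/

set_option linter.dupNamespace false

noncomputable section

namespace Summit.ABC.ABC.Theorems.ThetaPartIIDisplay

open Literature.IUT.LogVolume Literature.NumberTheory.DiophantineGeometry.GenEll
open Literature.NumberTheory.DiophantineGeometry

/-- **`Cor22.Thm110LegendreUpTo d₀` from the squeeze with `B_III` at every admissible point of degree `≤ d₀`**
(print's Step (viii) at the point, `display_of_squeezeIII`; `l ≠ 5` because a theta field exists and (P6) fails at
`5`). CONDITIONAL on `hsq`. [claim: Mochizuki2012, status: disputed] -/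
theorem thm110LegendreUpTo_of_squeezeIII {d₀ : ℕ}
    (hsq : ∀ P : NFPoint, P ∈ UP → P.degree ≤ d₀ → ∀ l : ℕ, l.Prime → 5 ≤ l →
      Cor22.AdmitsCore P → Cor22.CondP2 P l → Cor22.CondP5 P l → Cor22.CondP6 P l →
      (((l : ℝ) + 1) / 24 - 1 / (2 * l)) * Cor22.logQAvoid P {2, l} ≤
        ((l : ℝ) + 1) / 4 *
          ((1 + 12 * (Cor22.dmod P : ℝ) / l) * (P.logDiff + Cor22.logCondAvoid P {2, l})
            + 2 * Real.log l + 52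
            + 20 / 3 * Real.log (((2 ^ 12 * 3 ^ 3 * 5 * Cor22.dmod P : ℕ) : ℝ) * (l : ℝ))
              * (Nat.primeCounting (2 ^ 12 * 3 ^ 3 * 5 * Cor22.dmod P * l) : ℝ))
        + ThetaVolumeInput.archLogTheta l) :
    Cor22.Thm110LegendreUpTo d₀ := by
  intro η hη P hP hdeg l hl h5 hcore hP2 hP5 hP6
  have hU : P.InU := (show P.InU ∧ P.IsMinimal from hP).1
  have hne : l ≠ 5 := by
    rintro rfl
    obtain ⟨F, hNF, hF⟩ := Cor22.exists_isThetaField P hU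
    haveI := hNF
    exact Cor22.not_condP6_five_of_isThetaField hU F hF hP6
  exact display_of_squeezeIII hl h5 hne hη (hsq P hP hdeg l hl h5 hcore hP2 hP5 hP6)

/-- **Vojta in degree `≤ d₀` on compactly bounded sets from children (iii) and (ii′) at points of degree `≤ d₀`**:
[IUTchIII] Cor. 3.12 at every genuine Θ-volume datum of every admissible `(P, l)` with `[F_tpd : ℚ] ≤ d₀`, and the
hull-volume estimate with print's `B_III(P,l)` there, imply — child (i) being a theorem, the classical inputs of
Cor. 2.2/2.3 being theorems — that for every `1 ≤ d ≤ d₀`, `ε > 0` and every compactly bounded `K_V ⊆ U_P(ℚ̄)` whose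
support contains `2`, `ht ≲ (1+ε)(log-diff + log-cond)` on `K_V ∩ U_P(ℚ̄)^{≤d}`. CONDITIONAL; nothing asserted.
[cite: Mochizuki2012, IUTchIV Cor. 2.2–2.3 pp.41–55] [claim: Mochizuki2012, status: disputed] -/
theorem vojtaIneq_two_degLe_of_cor312_of_hullVolume {d₀ : ℕ}
    (h312 : ∀ P : NFPoint, P ∈ UP → P.degree ≤ d₀ → ∀ l : ℕ, l.Prime → 5 ≤ l →
      Cor22.AdmitsCore P → Cor22.CondP2 P l → Cor22.CondP5 P l → Cor22.CondP6 P l →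
        Cor22.Cor312AtDatum P l)
    (hvol : ∀ P : NFPoint, P ∈ UP → P.degree ≤ d₀ → ∀ l : ℕ, l.Prime → 5 ≤ l →
      Cor22.AdmitsCore P → Cor22.CondP2 P l → Cor22.CondP5 P l → Cor22.CondP6 P l →
        Cor22.HullVolumeAtDatum P l (((l : ℝ) + 1) / 4 *
          ((1 + 12 * (Cor22.dmod P : ℝ) / l) * (P.logDiff + Cor22.logCondAvoid P {2, l})
            + 2 * Real.log l + 52
            + 20 / 3 * Real.log (((2 ^ 12 * 3 ^ 3 * 5 * Cor22.dmod P : ℕ) : ℝ) * (l : ℝ))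
              * (Nat.primeCounting (2 ^ 12 * 3 ^ 3 * 5 * Cor22.dmod P * l) : ℝ)))) :
    ∀ d : ℕ, 0 < d → d ≤ d₀ → ∀ ε : ℝ, 0 < ε → ∀ D : CBData, D.SupportContains {2} →
      VojtaIneq D.toSet d ε :=
  Cor22.vojtaIneq_two_of_thm110LegendreUpTo <| thm110LegendreUpTo_of_squeezeIII
    fun P hP hdeg l hl h5 hcore hP2 hP5 h6 => by
      obtain ⟨T⟩ := Summit.ABC.ABC.Theorems.ThetaPartII.stub_thetaData P hP l hl h5 hcore hP2 hP5 h6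
      exact Summit.ABC.IUTFork.PointDict.logQAvoid_le_of_cor312AtDatum
        (h312 P hP hdeg l hl h5 hcore hP2 hP5 h6) (hvol P hP hdeg l hl h5 hcore hP2 hP5 h6) T hP.1

/-- **The «d = 1 cut»**: [IUTchIII] Cor. 3.12 at the Θ-data of the DEGREE-1 points of the `λ`-line (`λ ∈ ℚ`) and the
hull-volume estimate there imply Vojta/Szpiro (printed `(1+ε)`) for every `ε > 0` on the rational points of every
compactly bounded `K_V ⊆ U_P(ℚ̄)` whose support contains `2`. CONDITIONAL; no side taken on [IUTchIII] Cor. 3.12.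
[cite: Mochizuki2012, IUTchIV Cor. 2.2–2.3 pp.41–55] [claim: Mochizuki2012, status: disputed] -/
theorem vojtaIneq_two_degOne_of_cor312_of_hullVolume
    (h312 : ∀ P : NFPoint, P ∈ UP → P.degree ≤ 1 → ∀ l : ℕ, l.Prime → 5 ≤ l →
      Cor22.AdmitsCore P → Cor22.CondP2 P l → Cor22.CondP5 P l → Cor22.CondP6 P l →
        Cor22.Cor312AtDatum P l)
    (hvol : ∀ P : NFPoint, P ∈ UP → P.degree ≤ 1 → ∀ l : ℕ, l.Prime → 5 ≤ l →
      Cor22.AdmitsCore P → Cor22.CondP2 P l → Cor22.CondP5 P l → Cor22.CondP6 P l →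
        Cor22.HullVolumeAtDatum P l (((l : ℝ) + 1) / 4 *
          ((1 + 12 * (Cor22.dmod P : ℝ) / l) * (P.logDiff + Cor22.logCondAvoid P {2, l})
            + 2 * Real.log l + 52
            + 20 / 3 * Real.log (((2 ^ 12 * 3 ^ 3 * 5 * Cor22.dmod P : ℕ) : ℝ) * (l : ℝ))
              * (Nat.primeCounting (2 ^ 12 * 3 ^ 3 * 5 * Cor22.dmod P * l) : ℝ))))
    {ε : ℝ} (hε : 0 < ε) (D : CBData) (hD : D.SupportContains {2}) : VojtaIneq D.toSet 1 ε :=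
  vojtaIneq_two_degLe_of_cor312_of_hullVolume h312 hvol 1 one_pos le_rfl ε hε D hD

/-! ## The per-image reading (display-P line) -/

/-- **Vojta in degree `≤ d₀` from the display-P children (iii-P), (ii′-P) at points of degree `≤ d₀`** (abc-iut-S7's
per-image reading of `−|log(Θ)|`: `Cor22.Cor312PerImageAtDatum`, `Cor22.HullVolumePerImageAtDatum`, `gap_le_at_perImage`).
CONDITIONAL; nothing asserted. [cite: Mochizuki2012, IUTchIV Cor. 2.2–2.3 pp.41–55] [claim: Mochizuki2012, status: disputed] -/
theorem vojtaIneq_two_degLe_of_cor312PerImage_of_hullVolumePerImage {d₀ : ℕ}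
    (h312 : ∀ P : NFPoint, P ∈ UP → P.degree ≤ d₀ → ∀ l : ℕ, l.Prime → 5 ≤ l →
      Cor22.AdmitsCore P → Cor22.CondP2 P l → Cor22.CondP5 P l → Cor22.CondP6 P l →
        Cor22.Cor312PerImageAtDatum P l)
    (hvol : ∀ P : NFPoint, P ∈ UP → P.degree ≤ d₀ → ∀ l : ℕ, l.Prime → 5 ≤ l →
      Cor22.AdmitsCore P → Cor22.CondP2 P l → Cor22.CondP5 P l → Cor22.CondP6 P l →
        Cor22.HullVolumePerImageAtDatum P l (((l : ℝ) + 1) / 4 *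
          ((1 + 12 * (Cor22.dmod P : ℝ) / l) * (P.logDiff + Cor22.logCondAvoid P {2, l})
            + 2 * Real.log l + 52
            + 20 / 3 * Real.log (((2 ^ 12 * 3 ^ 3 * 5 * Cor22.dmod P : ℕ) : ℝ) * (l : ℝ))
              * (Nat.primeCounting (2 ^ 12 * 3 ^ 3 * 5 * Cor22.dmod P * l) : ℝ)))) :
    ∀ d : ℕ, 0 < d → d ≤ d₀ → ∀ ε : ℝ, 0 < ε → ∀ D : CBData, D.SupportContains {2} →
      VojtaIneq D.toSet d ε :=
  Cor22.vojtaIneq_two_of_thm110LegendreUpTo <| thm110LegendreUpTo_of_squeezeIII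
    fun P hP hdeg l hl h5 hcore hP2 hP5 h6 => by
      obtain ⟨T⟩ := Summit.ABC.ABC.Theorems.ThetaPartII.stub_thetaData P hP l hl h5 hcore hP2 hP5 h6
      rw [← Summit.ABC.IUTFork.PointDict.gap_eq T hP.1]
      exact Cor22.gap_le_at_perImage (h312 P hP hdeg l hl h5 hcore hP2 hP5 h6)
        (hvol P hP hdeg l hl h5 hcore hP2 hP5 h6) T

/-- **The «d = 1 cut», per-image reading**: Cor. 3.12 read per image at the Θ-data of the DEGREE-1 points of the
`λ`-line and the per-image hull estimate there imply Vojta/Szpiro (printed `(1+ε)`) on the rational points of every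
compactly bounded `K_V ∋ 2`. CONDITIONAL; no side taken. [cite: Mochizuki2012, IUTchIV Cor. 2.2–2.3 pp.41–55]
[claim: Mochizuki2012, status: disputed] -/
theorem vojtaIneq_two_degOne_of_cor312PerImage_of_hullVolumePerImage
    (h312 : ∀ P : NFPoint, P ∈ UP → P.degree ≤ 1 → ∀ l : ℕ, l.Prime → 5 ≤ l →
      Cor22.AdmitsCore P → Cor22.CondP2 P l → Cor22.CondP5 P l → Cor22.CondP6 P l →
        Cor22.Cor312PerImageAtDatum P l)
    (hvol : ∀ P : NFPoint, P ∈ UP → P.degree ≤ 1 → ∀ l : ℕ, l.Prime → 5 ≤ l →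
      Cor22.AdmitsCore P → Cor22.CondP2 P l → Cor22.CondP5 P l → Cor22.CondP6 P l →
        Cor22.HullVolumePerImageAtDatum P l (((l : ℝ) + 1) / 4 *
          ((1 + 12 * (Cor22.dmod P : ℝ) / l) * (P.logDiff + Cor22.logCondAvoid P {2, l})
            + 2 * Real.log l + 52
            + 20 / 3 * Real.log (((2 ^ 12 * 3 ^ 3 * 5 * Cor22.dmod P : ℕ) : ℝ) * (l : ℝ))
              * (Nat.primeCounting (2 ^ 12 * 3 ^ 3 * 5 * Cor22.dmod P * l) : ℝ))))
    {ε : ℝ} (hε : 0 < ε) (D : CBData) (hD : D.SupportContains {2}) : VojtaIneq D.toSet 1 ε :=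
  vojtaIneq_two_degLe_of_cor312PerImage_of_hullVolumePerImage h312 hvol 1 one_pos le_rfl ε hε D hD

/-! ## The «d = 1 cut» with the log-volume estimate DISCHARGED (appended) -/

/-- **Child (ii′) HOLDS at every admissible `(P, l)` of DEGREE 1** (`λ ∈ ℚ`): at a degree-1 point `d_mod = 1`
(`Cor22.dmod_eq_one_of_degree_le_one`), so the tensor-packet collections are slot-constant and abc-iut-S3's pinned
junction `PointDict.hullVolumeAtDatum_BIII_pinned_of_dmod_eq_one` applies, its last input (R4) being abc-iut-S1's
`Cor22.ThetaVolumeDatumAt.R4_towerFact` (every datum); `l ≥ 7` from (P6) (`ThetaPartII.seven_le_of_condP6`).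
So `Cor22.HullVolumeAtDatum P l (B_III P l)` is a THEOREM on the degree-1 points — the computable half of
[IUTchIV] Thm. 1.10 at `F_mod = ℚ`, kernel-checked by the cell. [cite: Mochizuki2012, IUTchIV Thm. 1.10 proof Steps (ii)–(viii) pp. 24–31] -/
theorem hullVolumeAtDatum_BIII_of_degree_le_one {P : NFPoint} (hP : P ∈ UP) (hdeg : P.degree ≤ 1) {l : ℕ}
    (hl : l.Prime) (h5 : 5 ≤ l) (h6 : Cor22.CondP6 P l) :
    Cor22.HullVolumeAtDatum P l (((l : ℝ) + 1) / 4 *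
      ((1 + 12 * (Cor22.dmod P : ℝ) / l) * (P.logDiff + Cor22.logCondAvoid P {2, l})
        + 2 * Real.log l + 52
        + 20 / 3 * Real.log (((2 ^ 12 * 3 ^ 3 * 5 * Cor22.dmod P : ℕ) : ℝ) * (l : ℝ))
          * (Nat.primeCounting (2 ^ 12 * 3 ^ 3 * 5 * Cor22.dmod P * l) : ℝ))) :=
  Summit.ABC.IUTFork.PointDict.hullVolumeAtDatum_BIII_pinned_of_dmod_eq_one hP
    (ThetaPartII.seven_le_of_condP6 hP hl h5 h6) (Cor22.dmod_eq_one_of_degree_le_one hdeg)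
    fun T => T.R4_towerFact hP

/-- **THE «d = 1 CUT», UNCONDITIONAL ON THE VOLUME SIDE**: [IUTchIII] Cor. 3.12 at the genuine Θ-data of the
DEGREE-1 points of the `λ`-line (`stub_cor312` restricted to `P.degree ≤ 1` — the ONLY hypothesis; claim form,
DISPUTED) implies Vojta/Szpiro with the printed `(1+ε)` for every `ε > 0` on the RATIONAL points of every compactly
bounded `K_V ⊆ U_P(ℚ̄)` whose support contains `2` (for the Frey–Legendre parameter `λ = a/(a+b)`: the abc triples
with `a ≍ b ≍ c` and `v₂(abc)` bounded). Everything else — the existence of the Θ-data (child (i)), the log-volume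
computation (child (ii′) at `d_mod = 1`), Cor. 2.2 (i)/(iii), the Galois-image input, the prime-number theorem input,
the vacuity remark of Cor. 2.3 — is a THEOREM of the tree; no `GenEllTwo`, no Step-(v) symmetrisation residue.
CONDITIONAL (`proof.conditional`) on the one disputed input; nothing asserted; no side taken.
[cite: Mochizuki2012, IUTchIV Cor. 2.2–2.3 pp.41–55] [claim: Mochizuki2012, status: disputed] -/
theorem vojtaIneq_two_degOne_of_cor312
    (h312 : ∀ P : NFPoint, P ∈ UP → P.degree ≤ 1 → ∀ l : ℕ, l.Prime → 5 ≤ l →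
      Cor22.AdmitsCore P → Cor22.CondP2 P l → Cor22.CondP5 P l → Cor22.CondP6 P l →
        Cor22.Cor312AtDatum P l)
    {ε : ℝ} (hε : 0 < ε) (D : CBData) (hD : D.SupportContains {2}) : VojtaIneq D.toSet 1 ε :=
  vojtaIneq_two_degOne_of_cor312_of_hullVolume h312
    (fun _ hP hdeg _ hl h5 _ _ _ h6 => hullVolumeAtDatum_BIII_of_degree_le_one hP hdeg hl h5 h6) hε D hD

end Summit.ABC.ABC.Theorems.ThetaPartIIDisplay

end
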